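import Summits.BirchSwinnertonDyer.BirchSwinnertonDyer.Theorems.ResidualThetaTransportAtTwoResidualSignedLambdaLowerCMAtTwoImprimitiveDuality
import HarnessLib

/-!
# STUB-IDEAS `stub_cmLambdaLower` · k3 · gen 5 — the DIRECT-SUM four-term cut («one Poitou–Tate pair, not two»)

Stub-ideation sketch (planner `sidea-stub_cmLambdaLower-3-g5`; idea file `Ideas/stub-cmlambdalower-k3-g5.md`).
Route `ResidualThetaTransportAtTwo` (RTT); crux (R≥)ᵖ `ResidualThetaCountLowerPureAtTwo` (stmt-BirchSwinnertonDyer-26074);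
stub `Bt26Lambda.stub_cmLambdaLower : …Theses.ResidualThetaTransportAtTwo.ResidualSignedLambdaLowerCMAtTwo`
(= route item RSL_g, stmt-BirchSwinnertonDyer-22608) — its statement is FIXED and is not re-typed here.

PURE MODULE ALGEBRA (no curve, no Galois cohomology, no `sorry`, no new `def … : Prop` about arithmetic objects).
**BSD is NOT proved by any of this; 22608 / 26074 stay OPEN.**  What is kernel-checked here is the GLUE of the
decomposition proposed on the card:

* §A  the direct-sum source `Q := (Λ × P) ⧸ Λ∙ẑ` (`Λ = A⟦T⟧`, `P = (⊕_{w∣S₀} H¹(ℚ_{∞,w}, A_g))⋆`, `ẑ = (Col⁺_g loc₂ z, loc_{S₀} z)`):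
      the short exact sequence `0 → P → Q → Λ/(ẑ.1) → 0` (`dsIn`, `dsOut`, injective/exact/onto when `ẑ.1 ≠ 0`),
      torsion of `Q`, and — BY NAME through the landed kit `CharIdealLambda.add_le_finrank_baseChange_of_shortExact` —
      `m ≤ λ_K(Λ/(ẑ.1)) ∧ s ≤ λ_K(P) ⇒ m + s ≤ λ_K(Q)`  (the S₀-increment is counted on the SOURCE side, locally);
* §B  the ZETA-QUOTIENT TRICK: for `H →f₁ Q' →f₂ X' →f₃ X0` with ONLY `ker f₂ ≤ range f₁`, `range f₂ ≤ ker f₃`, `f₃` onto,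
      the induced maps `H/Λz → Q'/Λ f₁z → X'/Λ f₂f₁z → X0` satisfy the SAME three one-sided conditions — with NO
      reciprocity hypothesis `f₂ (f₁ z) = 0`; and `λ_K(X'/N) ≤ λ_K(X')`;
* §C  the MASTER GLUE `directSum_fourTerm_corank_ge`: (hker : ONE one-sided Poitou–Tate inclusion for the pair
      (fine ≤ plus-S₀-relaxed)) + (hs : local count `s ≤ λ_K(P)`) + (hd, hflank : the HOLD clauses (i_D), (ii_D) in
      `X₀ = Y^fine`-currency, slack `e`) + (`(f₁ z).1 ≠ 0`) ⇒ `d + s ≤ λ_K(X')` for `X' = X⁺_{S₀}` — composing BY NAME with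
      `CharIdealLambda.le_finrank_baseChange_of_fourTerm_oneSided_decorated` and `…finite_baseChange_of_isTorsion`.
  No `X⁺_∅`, no imprimitive three-term step, no Greenberg–Vatsal surjectivity, no `𝔖⁺ = 0`, no reciprocity law enter.

References: [Kobayashi2003] Thm. 7.3 ((7.21)); [GreenbergVatsal2000] §2; [MazurRubin2004] Thm. 2.3.4; [Washington1997] §13.2.
-/

set_option autoImplicit false
set_option linter.dupNamespace false

noncomputable section

open scoped TensorProduct Classical

namespace Summit.BirchSwinnertonDyer.BirchSwinnertonDyer.Cruxes.ResidualThetaCountLowerPureAtTwo.StubIdeasK3G5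

open Summit.BirchSwinnertonDyer.BirchSwinnertonDyer.Theorems

universe u w

/-! ## §A  The direct-sum source `(R × P) ⧸ R∙ẑ` and `0 → P → (R × P)/R∙ẑ → R/(ẑ.1) → 0` -/

section DirectSum

variable {R : Type u} [CommRing R] {P : Type u} [AddCommGroup P] [Module R P]

/-- `i : P → (R × P) ⧸ R∙ẑ`, `p ↦ [(0, p)]`. -/
def dsIn (zh : R × P) : P →ₗ[R] ((R × P) ⧸ Submodule.span R {zh}) :=
  (Submodule.span R {zh}).mkQ ∘ₗ LinearMap.inr R R P

/-- `π : (R × P) ⧸ R∙ẑ → R ⧸ (ẑ.1)`, `[(a, p)] ↦ [a]`. -/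
def dsOut (zh : R × P) : ((R × P) ⧸ Submodule.span R {zh}) →ₗ[R] (R ⧸ Ideal.span ({zh.1} : Set R)) :=
  (Submodule.span R {zh}).liftQ ((Ideal.span ({zh.1} : Set R)).mkQ ∘ₗ LinearMap.fst R R P) (by
    rw [Submodule.span_singleton_le_iff_mem, LinearMap.mem_ker, LinearMap.comp_apply,
      LinearMap.fst_apply, Submodule.mkQ_apply, Submodule.Quotient.mk_eq_zero]
    exact Ideal.mem_span_singleton_self zh.1)

theorem dsOut_mk (zh : R × P) (x : R × P) :
    dsOut zh (Submodule.Quotient.mk x) = Submodule.Quotient.mk x.1 := by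
  simp [dsOut]

theorem dsIn_apply (zh : R × P) (p : P) :
    dsIn zh p = Submodule.Quotient.mk ((0, p) : R × P) := by
  simp [dsIn]

theorem dsOut_dsIn (zh : R × P) (p : P) : dsOut zh (dsIn zh p) = 0 := by
  rw [dsIn_apply, dsOut_mk]
  simp

/-- `i` is injective as soon as `ẑ.1` is a non-zero-divisor (for `Λ = A⟦T⟧`: `Col⁺_g(loc₂ z) ≠ 0`). -/
theorem dsIn_injective {zh : R × P} (hF : zh.1 ∈ nonZeroDivisors R) : Function.Injective (dsIn zh) := by
  intro p q hpq
  rw [dsIn_apply, dsIn_apply, Submodule.Quotient.eq, Submodule.mem_span_singleton] at hpq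
  obtain ⟨r, hr⟩ := hpq
  have h1 : r * zh.1 = 0 := by
    have := congrArg Prod.fst hr
    simpa using this
  have hr0 : r = 0 := (mem_nonZeroDivisors_iff.mp hF).2 r h1
  have h2 : (0 : P) = p - q := by
    have := congrArg Prod.snd hr
    simpa [hr0] using this
  exact (sub_eq_zero.mp h2.symm)

/-- exactness in the middle: `ker π = range i`. -/
theorem dsIn_exact (zh : R × P) : Function.Exact (dsIn zh) (dsOut zh) := by
  intro q
  constructor
  · intro hq
    obtain ⟨x, rfl⟩ := Submodule.Quotient.mk_surjective (Submodule.span R {zh}) q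
    rw [dsOut_mk, Submodule.Quotient.mk_eq_zero, Ideal.mem_span_singleton'] at hq
    obtain ⟨r, hr⟩ := hq
    refine ⟨x.2 - r • zh.2, ?_⟩
    rw [dsIn_apply, Submodule.Quotient.eq, Submodule.mem_span_singleton]
    refine ⟨-r, ?_⟩
    ext
    · simp [← hr]
    · simp
  · rintro ⟨p, rfl⟩
    exact dsOut_dsIn zh p

theorem dsOut_surjective (zh : R × P) : Function.Surjective (dsOut zh) := by
  intro y
  obtain ⟨a, rfl⟩ := Submodule.Quotient.mk_surjective _ y
  exact ⟨Submodule.Quotient.mk (a, 0), by rw [dsOut_mk]⟩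

/-- a quotient of a torsion module is torsion. -/
theorem isTorsion_quotient {M : Type u} [AddCommGroup M] [Module R M] (hM : Module.IsTorsion R M)
    (N : Submodule R M) : Module.IsTorsion R (M ⧸ N) := by
  intro x
  obtain ⟨m, rfl⟩ := Submodule.Quotient.mk_surjective N x
  obtain ⟨a, ha⟩ := @hM m
  refine ⟨a, ?_⟩
  rw [Submonoid.smul_def, ← Submodule.Quotient.mk_smul, ← Submonoid.smul_def, ha, Submodule.Quotient.mk_zero]

/-- torsion is closed under the extension `0 → P → (R × P)/R∙ẑ → R/(ẑ.1) → 0` (`R` a domain, `ẑ.1 ≠ 0`). -/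
theorem isTorsion_dsq [IsDomain R] {zh : R × P} (hF : zh.1 ≠ 0) (hP : Module.IsTorsion R P) :
    Module.IsTorsion R ((R × P) ⧸ Submodule.span R {zh}) := by
  intro q
  obtain ⟨x, rfl⟩ := Submodule.Quotient.mk_surjective (Submodule.span R {zh}) q
  obtain ⟨⟨s, hs⟩, hsp⟩ := @hP (zh.1 • x.2 - x.1 • zh.2)
  refine ⟨⟨s * zh.1, mul_mem hs (mem_nonZeroDivisors_of_ne_zero hF)⟩, ?_⟩
  rw [Submonoid.mk_smul, ← Submodule.Quotient.mk_smul, Submodule.Quotient.mk_eq_zero,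
    Submodule.mem_span_singleton]
  refine ⟨s * x.1, ?_⟩
  rw [Submonoid.mk_smul, smul_sub, sub_eq_zero] at hsp
  ext
  · simp only [Prod.smul_fst, smul_eq_mul]
    ring
  · simp only [Prod.smul_snd, mul_smul]
    rw [← hsp, smul_comm]

end DirectSum

/-! ## §A-λ  `m ≤ λ_K(Λ/(ẑ.1))`, `s ≤ λ_K(P)` ⇒ `m + s ≤ λ_K((Λ × P)/Λ∙ẑ)` — BY NAME through the landed kit -/

section DirectSumLambda

variable {A : Type u} [CommRing A] [IsDomain A] [IsDiscreteValuationRing A]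
  [IsAdicComplete (IsLocalRing.maximalIdeal A) A]
variable (K : Type w) [Field K] [Algebra A K] [IsFractionRing A K]
variable {P : Type u} [AddCommGroup P] [Module (PowerSeries A) P] [Module A P]
  [IsScalarTower A (PowerSeries A) P] [Module.Finite (PowerSeries A) P]

/-- **λ of the direct-sum source.** For `P` a finitely generated torsion `Λ`-module and `ẑ ∈ Λ × P` with `ẑ.1 ≠ 0`:
`m ≤ λ_K(Λ/(ẑ.1))` and `s ≤ λ_K(P)` give `m + s ≤ λ_K((Λ × P)/Λ∙ẑ)` (in fact equality; `≥` is what RSL_g consumes).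
Instantiation: `m := d + e` from the HOLD clause (i_D) via `CharIdealLambda.add_le_finrank_baseChange_quotient_span_of_eq_C_mul_mul`,
`s := Σ_g(S₀)` from the local count. [cite: Washington1997, §13.2] [cite: GreenbergVatsal2000, §2 (Prop. 2.4)] -/
theorem add_le_finrank_baseChange_dsq (hP : Module.IsTorsion (PowerSeries A) P) {zh : PowerSeries A × P}
    (hF : zh.1 ≠ 0) {m s : ℕ} (hs : s ≤ Module.finrank K (K ⊗[A] P))
    (hm : m ≤ Module.finrank K (K ⊗[A] (PowerSeries A ⧸ Ideal.span ({zh.1} : Set (PowerSeries A))))) :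
    m + s ≤ Module.finrank K (K ⊗[A] ((PowerSeries A × P) ⧸ Submodule.span (PowerSeries A) {zh})) := by
  have hi : Function.Injective ((dsIn zh).restrictScalars A) := fun a b h ↦
    dsIn_injective (mem_nonZeroDivisors_of_ne_zero hF) (by simpa only [LinearMap.coe_restrictScalars] using h)
  have he : Function.Exact ((dsIn zh).restrictScalars A) ((dsOut zh).restrictScalars A) := fun q ↦ by
    simp only [LinearMap.coe_restrictScalars]
    exact dsIn_exact zh q
  have hsu : Function.Surjective ((dsOut zh).restrictScalars A) := fun y ↦ by
    simp only [LinearMap.coe_restrictScalars]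
    exact dsOut_surjective zh y
  have hXS : Module.IsTorsion (PowerSeries A) ((PowerSeries A × P) ⧸ Submodule.span (PowerSeries A) {zh}) :=
    isTorsion_dsq hF hP
  exact CharIdealLambda.add_le_finrank_baseChange_of_shortExact K hXS
    ((dsIn zh).restrictScalars A) ((dsOut zh).restrictScalars A) hi he hsu hs hm

end DirectSumLambda

/-! ## §B  The zeta-quotient trick: one-sided exactness descends to `H/Rz → Q'/R f₁z → X'/R f₂f₁z → X0`
with NO reciprocity hypothesis -/

section ZetaQuotient

variable {R : Type u} [CommRing R] {H Q' X' X0 : Type u}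
  [AddCommGroup H] [Module R H] [AddCommGroup Q'] [Module R Q']
  [AddCommGroup X'] [Module R X'] [AddCommGroup X0] [Module R X0]
variable (f₁ : H →ₗ[R] Q') (f₂ : Q' →ₗ[R] X') (f₃ : X' →ₗ[R] X0) (z : H)

/-- `H/Rz → Q'/R∙f₁z` induced by `f₁`. -/
def qmap₁ : (H ⧸ Submodule.span R {z}) →ₗ[R] (Q' ⧸ Submodule.span R {f₁ z}) :=
  Submodule.mapQ _ _ f₁ (by
    rw [Submodule.span_singleton_le_iff_mem, Submodule.mem_comap]
    exact Submodule.mem_span_singleton_self (f₁ z))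

/-- `Q'/R∙f₁z → X'/R∙f₂f₁z` induced by `f₂` (the target is quotiented by the image of `ẑ`: this is what removes
the reciprocity hypothesis `f₂ (f₁ z) = 0`). -/
def qmap₂ : (Q' ⧸ Submodule.span R {f₁ z}) →ₗ[R] (X' ⧸ Submodule.span R {f₂ (f₁ z)}) :=
  Submodule.mapQ _ _ f₂ (by
    rw [Submodule.span_singleton_le_iff_mem, Submodule.mem_comap]
    exact Submodule.mem_span_singleton_self (f₂ (f₁ z)))

/-- `X'/R∙f₂f₁z → X0` induced by `f₃` (well defined because `f₃ ∘ f₂ = 0`). -/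
def qmap₃ (hcomp : LinearMap.range f₂ ≤ LinearMap.ker f₃) :
    (X' ⧸ Submodule.span R {f₂ (f₁ z)}) →ₗ[R] X0 :=
  Submodule.liftQ _ f₃ (by
    rw [Submodule.span_singleton_le_iff_mem]
    exact hcomp ⟨f₁ z, rfl⟩)

/-- **one-sided exactness at `Q` descends**: `ker f₂ ≤ range f₁ ⇒ ker f̄₂ ≤ range f̄₁`. -/
theorem ker_qmap₂_le_range_qmap₁ (hker : LinearMap.ker f₂ ≤ LinearMap.range f₁) :
    LinearMap.ker (qmap₂ f₁ f₂ z) ≤ LinearMap.range (qmap₁ f₁ z) := by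
  intro x hx
  obtain ⟨q, rfl⟩ := Submodule.Quotient.mk_surjective _ x
  rw [LinearMap.mem_ker, qmap₂, Submodule.mapQ_apply, Submodule.Quotient.mk_eq_zero,
    Submodule.mem_span_singleton] at hx
  obtain ⟨r, hr⟩ := hx
  have hq : q - r • f₁ z ∈ LinearMap.ker f₂ := by
    rw [LinearMap.mem_ker, map_sub, map_smul, hr, sub_self]
  obtain ⟨y, hy⟩ := hker hq
  refine ⟨Submodule.Quotient.mk y, ?_⟩
  rw [qmap₁, Submodule.mapQ_apply, hy, Submodule.Quotient.eq, Submodule.mem_span_singleton]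
  exact ⟨-r, by rw [neg_smul, sub_sub_cancel_left]⟩

/-- composition zero descends. -/
theorem range_qmap₂_le_ker_qmap₃ (hcomp : LinearMap.range f₂ ≤ LinearMap.ker f₃) :
    LinearMap.range (qmap₂ f₁ f₂ z) ≤ LinearMap.ker (qmap₃ f₁ f₂ f₃ z hcomp) := by
  rintro _ ⟨x, rfl⟩
  obtain ⟨q, rfl⟩ := Submodule.Quotient.mk_surjective _ x
  rw [LinearMap.mem_ker, qmap₂, Submodule.mapQ_apply, qmap₃, Submodule.liftQ_apply]
  exact hcomp ⟨q, rfl⟩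

/-- surjectivity descends. -/
theorem qmap₃_surjective (hcomp : LinearMap.range f₂ ≤ LinearMap.ker f₃) (hh : Function.Surjective f₃) :
    Function.Surjective (qmap₃ f₁ f₂ f₃ z hcomp) := by
  intro y
  obtain ⟨x, rfl⟩ := hh y
  exact ⟨Submodule.Quotient.mk x, by rw [qmap₃, Submodule.liftQ_apply]⟩

end ZetaQuotient

section QuotMono

variable {A : Type u} [CommRing A] (K : Type w) [Field K] [Algebra A K]
variable {R : Type u} [CommRing R] [Algebra A R] {X' : Type u} [AddCommGroup X'] [Module R X'] [Module A X']
  [IsScalarTower A R X']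

/-- `λ_K(X'/N) ≤ λ_K(X')` (`K ⊗_A ·` is right exact). -/
theorem finrank_baseChange_quotient_le (N : Submodule R X') [Module.Finite K (K ⊗[A] X')] :
    Module.finrank K (K ⊗[A] (X' ⧸ N)) ≤ Module.finrank K (K ⊗[A] X') := by
  set π : K ⊗[A] X' →ₗ[K] K ⊗[A] (X' ⧸ N) := (N.mkQ.restrictScalars A).baseChange K with hπ
  have hπs : Function.Surjective π := by
    rw [hπ, LinearMap.baseChange_eq_ltensor]
    exact LinearMap.lTensor_surjective K (Submodule.mkQ_surjective N)
  calc Module.finrank K (K ⊗[A] (X' ⧸ N))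
        = Module.finrank K (LinearMap.range π) := by rw [LinearMap.range_eq_top.mpr hπs, finrank_top]
    _ ≤ Module.finrank K (K ⊗[A] X') := π.finrank_range_le

end QuotMono

/-! ## §C  MASTER GLUE — the decomposition of the algebraic side of RSL_g into
(hker) ONE one-sided Poitou–Tate inclusion · (hs) the local count · (hd, hflank) the HOLD · (hF) non-vanishing -/

section Master

variable {A : Type u} [CommRing A] [IsDomain A] [IsDiscreteValuationRing A]
  [IsAdicComplete (IsLocalRing.maximalIdeal A) A]
variable (K : Type w) [Field K] [Algebra A K] [IsFractionRing A K]
variable {H P X' X0 : Type u}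
  [AddCommGroup H] [Module (PowerSeries A) H] [Module A H] [IsScalarTower A (PowerSeries A) H]
  [AddCommGroup P] [Module (PowerSeries A) P] [Module A P] [IsScalarTower A (PowerSeries A) P]
  [Module.Finite (PowerSeries A) P]
  [AddCommGroup X'] [Module (PowerSeries A) X'] [Module A X'] [IsScalarTower A (PowerSeries A) X']
  [Module.Finite (PowerSeries A) X']
  [AddCommGroup X0] [Module (PowerSeries A) X0] [Module A X0] [IsScalarTower A (PowerSeries A) X0]

/-- **MASTER GLUE (direct-sum four-term, one-sided, decoration-tolerant).**
Data (all `Λ = A⟦T⟧`-linear): `f₁ : H → Λ × P` (`= (Col⁺_g ∘ loc₂, loc_{S₀})` on `H = 𝐇¹ = I.H`),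
`f₂ : Λ × P → X'` (dual of `(loc₂, loc_{S₀}) : Sel⁺_{S₀} → L⁺ ⊕ ⊕_w H¹(ℚ_{∞,w}, A_g)`, `X' = X⁺_{S₀}`),
`f₃ : X' → X0` (dual of `Sel^fine ⊆ Sel⁺_{S₀}`, `X0 = Y^fine = X₀`), `z ∈ H` (the HOLD's zeta class).
Sub-stubs consumed: `hker` (ONE one-sided Poitou–Tate inclusion for the pair fine ≤ plus-S₀-relaxed), `hcomp`, `hh`
(definitional on the carriers), `hs : s ≤ λ_K(P)` (local count, `s = Σ_g(S₀)`), `hd : d + e ≤ λ_K(Λ/((f₁ z).1))`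
(HOLD (i_D) read by normλ-additivity), `hflank : λ_K(H/Λz) ≤ λ_K(X0) + e` (HOLD (ii_D) in `X₀`-currency), `hF`.
Conclusion `d + s ≤ λ_K(X')` — the corank statement (f) for `X⁺_{S₀}`; no `X⁺_∅`, no Greenberg–Vatsal surjectivity,
no `𝔖⁺ = 0`, no reciprocity `f₂ (f₁ z) = 0` is used. [cite: Kobayashi2003, Thm. 7.3 ((7.21), p. 13)]
[cite: GreenbergVatsal2000, §2] [cite: Washington1997, §13.2] -/
theorem directSum_fourTerm_corank_ge (hP : Module.IsTorsion (PowerSeries A) P)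
    (hX' : Module.IsTorsion (PowerSeries A) X')
    (f₁ : H →ₗ[PowerSeries A] (PowerSeries A × P)) (f₂ : (PowerSeries A × P) →ₗ[PowerSeries A] X')
    (f₃ : X' →ₗ[PowerSeries A] X0) (z : H)
    (hker : LinearMap.ker f₂ ≤ LinearMap.range f₁) (hcomp : LinearMap.range f₂ ≤ LinearMap.ker f₃)
    (hh : Function.Surjective f₃)
    [Module.Finite K (K ⊗[A] (H ⧸ Submodule.span (PowerSeries A) {z}))]
    {d e s : ℕ} (hF : (f₁ z).1 ≠ 0)
    (hd : d + e ≤ Module.finrank K (K ⊗[A] (PowerSeries A ⧸ Ideal.span ({(f₁ z).1} : Set (PowerSeries A)))))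
    (hs : s ≤ Module.finrank K (K ⊗[A] P))
    (hflank : Module.finrank K (K ⊗[A] (H ⧸ Submodule.span (PowerSeries A) {z})) ≤
      Module.finrank K (K ⊗[A] X0) + e) :
    d + s ≤ Module.finrank K (K ⊗[A] X') := by
  have hQ : Module.IsTorsion (PowerSeries A) ((PowerSeries A × P) ⧸ Submodule.span (PowerSeries A) {f₁ z}) :=
    isTorsion_dsq hF hP
  have hX : Module.IsTorsion (PowerSeries A) (X' ⧸ Submodule.span (PowerSeries A) {f₂ (f₁ z)}) :=
    isTorsion_quotient hX' _
  have hm : d + s + e ≤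
      Module.finrank K (K ⊗[A] ((PowerSeries A × P) ⧸ Submodule.span (PowerSeries A) {f₁ z})) := by
    have := add_le_finrank_baseChange_dsq K hP hF hs hd
    omega
  have hker' : LinearMap.ker ((qmap₂ f₁ f₂ z).restrictScalars A) ≤
      LinearMap.range ((qmap₁ f₁ z).restrictScalars A) := by
    intro x hx
    obtain ⟨y, hy⟩ := (ker_qmap₂_le_range_qmap₁ f₁ f₂ z hker) (by simpa [LinearMap.mem_ker] using hx)
    exact ⟨y, hy⟩
  have hcomp' : LinearMap.range ((qmap₂ f₁ f₂ z).restrictScalars A) ≤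
      LinearMap.ker ((qmap₃ f₁ f₂ f₃ z hcomp).restrictScalars A) := by
    rintro _ ⟨y, rfl⟩
    have := (range_qmap₂_le_ker_qmap₃ f₁ f₂ f₃ z hcomp) ⟨y, rfl⟩
    simpa [LinearMap.mem_ker] using this
  have key := CharIdealLambda.le_finrank_baseChange_of_fourTerm_oneSided_decorated K (H2 := X0) hQ hX
    ((qmap₁ f₁ z).restrictScalars A) ((qmap₂ f₁ f₂ z).restrictScalars A)
    ((qmap₃ f₁ f₂ f₃ z hcomp).restrictScalars A) hker' hcomp'
    (qmap₃_surjective f₁ f₂ f₃ z hcomp hh) hm hflank le_rfl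
  haveI := CharIdealLambda.finite_baseChange_of_isTorsion K X' hX'
  exact key.trans (finrank_baseChange_quotient_le K (Submodule.span (PowerSeries A) {f₂ (f₁ z)}))

end Master

end Summit.BirchSwinnertonDyer.BirchSwinnertonDyer.Cruxes.ResidualThetaCountLowerPureAtTwo.StubIdeasK3G5

end
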